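import Summits.ResolutionOfSingularities.ResolutionOfSingularities.Theorems.FrobeniusClosingSteerCore4GenExit
import Summits.ResolutionOfSingularities.ResolutionOfSingularities.Theorems.FrobeniusClosingSteerCore4RunTrichotomy
import HarnessLib

/-!
# Crux `Steer` (stmt-ResolutionOfSingularities-16345), line `switching_dichotomy` — P1ᴹ: the GENERATOR EXIT ON AN
# ARBITRARY MODEL (not only on a member of the point sequence; Theses-free body)

OURS (campaign `res-hironaka`, rung L ★L-G4, slot W4.1, chain W4.1, seat `res-D-pv-028` — STAGED CONVERT «Alternation»
on the frontier residuals Φ3ᴸˢ/Φ4ᴸˢ of the skeleton of record r20; replaces the role of no printed item; NOT a statement of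
the manuscript under review; AI review is weaker than expert review).

**Why.** The registered frontier residuals Φ3ᴸˢ `EternalStallPhaseSSL` / Φ4ᴸˢ `EternalAlternationSSL` (and
`NonSwitchingCore`) carry the hypotheses «no MEMBER `R M` of the point sequence is an exit stage» and «no MEMBER is
log-final». Exits and log-final presentations are NOT upward-stable under domination (res-L0-w41-tri-1, TRIAGE v4 lens
P-b, CHAIN W4.1 v5.4 item 5): a datum may exit on a finitely generated model `A₁ ⊇ A₀` inside `O` that is NOT a member,
so the residuals are «true but unsharp» on such data. The log-final side is already dischargeable in MODEL form (the
registered `stub_logFinalExitM : ∀ p, LogFinalExitM p` quantifies over all finitely generated regular models `A₁` of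
`Frac A₀`). This file supplies the EXIT side in model form, so that the phase-machine composition can split off BOTH exits
on every model before the frontier residuals, which then carry the strictly stronger hypotheses «no finitely generated
model `A₀ ≤ A₁ ⊆ O`, regular at the centre of `O`, is log-final or carries a generator in order-one form».

* `GenExitModel.genExitModel` — **P1ᴹ**: for `t ^ p ∈ A₀ ⊆ O` (`A₀` finitely generated, `Frac (A₀[t]) = K`, the centre
  of `O` on `A₀` non-trivial: some non-zero `a ∈ A₀` has positive value — in the skeleton this is `CoreDatum`'s
  `¬ dim ≤ 2` through `exists_mem_centre_of_not_ringKrullDim_le_two`), EVERY finitely generated `A₁ ⊇ A₀` inside `O`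
  that is regular at the centre of `O` and EVERY generator `s'` over `S := (A₁)_{𝔪_O ∩ A₁}` (`s' ^ p ∈ S`, `t ∈ S[s']`)
  in ORDER-ONE FORM (`s' ^ p − g ^ p` a one-element part of a regular system of parameters of `S`, `g ∈ S`) give
  `Concl O A₀ t` (unfolded). Proof: the point sequence of `A₁` along `O` exists (`stub_switchingSetup`, landed r5),
  and the landed member-form `genExit` (p495493) at its stage `M = 0` concludes for `(A₁, t)`; push down along
  `A₀ ≤ A₁`.
* `GenExitModel.genExitModel_of_not_ringKrullDim_le_two` — the same with the skeleton's binder `¬ dim ≤ 2` in place of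
  the non-trivial-centre hypothesis.

[cite: HeinzerEtAl2015, Prop. 4.4] [cite: NovacoskiSpivakovsky2014, Lemma 2.5] [folklore]
-/

noncomputable section

-- `Summit.<S>.<S>.…` duplicates the summit name by design (single-problem summit).
set_option linter.dupNamespace false

open IsLocalRing

namespace Summit.ResolutionOfSingularities.ResolutionOfSingularities.Theorems.SwitchingDichotomy

open Literature.AlgebraicGeometry.Resolution

namespace GenExitModel

/-- **P1ᴹ — the generator exit on an arbitrary finitely generated model.** For fields `k ⊆ K` of characteristic `p`,
a valuation ring `O` of `K`, a finitely generated `A₀ ⊆ O` with `t ^ p ∈ A₀`, `Frac (A₀[t]) = K` and a non-zero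
element of positive value, every finitely generated `A₁ ⊇ A₀` inside `O` regular at the centre of `O`, and every
`s'` with `s' ^ p ∈ S := (A₁)_{𝔪_O ∩ A₁}`, `t ∈ S[s']` and `s' ^ p − g ^ p` a one-element part of a regular system of
parameters of `S` for some `g ∈ S`: some finitely generated `A ⊇ A₀` with `t ∈ A ⊆ O`, `Frac A = K` is regular at
the centre of `O`. [cite: HeinzerEtAl2015, Prop. 4.4] [cite: NovacoskiSpivakovsky2014, Lemma 2.5] [folklore] -/
theorem genExitModel :
    ∀ p : ℕ, p.Prime → ∀ (k K : Type) [Field k] [CharP k p] [Field K] [Algebra k K]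
      (O : ValuationSubring K) (A₀ : Subalgebra k K) (h₀ : A₀.toSubring ≤ O.toSubring) (t : K),
      A₀.FG → t ^ p ∈ A₀ → IsFractionRing (Algebra.adjoin k (insert t (A₀ : Set K))) K →
      (∃ a ∈ A₀, a ≠ 0 ∧ O.valuation a < 1) →
      ∀ (A₁ : Subalgebra k K) (h₁ : A₁.toSubring ≤ O.toSubring), A₀ ≤ A₁ → A₁.FG →
        IsRegularLocalRing (Localization.AtPrime
          (Ideal.comap (Subring.inclusion h₁) (IsLocalRing.maximalIdeal O))) →
        ∀ s' : K, s' ^ p ∈ locAtCentre A₁.toSubring O →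
          t ∈ Subring.closure (insert s' (locAtCentre A₁.toSubring O : Set K)) →
          (∃ g ∈ locAtCentre A₁.toSubring O, ∃ (_ : IsLocalRing (locAtCentre A₁.toSubring O))
            (z : Fin 1 → locAtCentre A₁.toSubring O), IsRsopPart z ∧
            ((z 0 : locAtCentre A₁.toSubring O) : K) = s' ^ p - g ^ p) →
          ∃ (A : Subalgebra k K) (h : A.toSubring ≤ O.toSubring), A₀ ≤ A ∧ t ∈ A ∧ A.FG ∧
            IsFractionRing A K ∧ IsRegularLocalRing (Localization.AtPrime
              (Ideal.comap (Subring.inclusion h) (IsLocalRing.maximalIdeal O))) := by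
  intro p hp k K _ _ _ _ O A₀ h₀ t _hfg htp hfr ha A₁ h₁ hle hfg₁ hreg₁ s' hsp ht hone
  obtain ⟨a, haA, ha0, hva⟩ := ha
  -- the point sequence of the model `A₁` along `O` (landed `stub_switchingSetup`)
  obtain ⟨R, hR0, hRq, -, -, -⟩ := stub_switchingSetup k K O A₁ h₁ hreg₁ ⟨a, hle haA, ha0, hva⟩
  -- `Frac (A₁[t]) = K`
  haveI := hfr
  have hfr₁ : IsFractionRing (Algebra.adjoin k (insert t (A₁ : Set K))) K :=
    isFractionRing_subalgebra_of_le (Algebra.adjoin k (insert t (A₀ : Set K))) _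
      (Algebra.adjoin_mono (Set.insert_subset_insert fun x hx => hle hx))
  -- the member-form generator exit at stage `M = 0` of that sequence, for the datum `(A₁, t)`
  obtain ⟨A, h, hA₁A, htA, hfgA, hfrA, hregA⟩ := genExit p hp k K O A₁ h₁ t hfg₁ (hle htp) hfr₁ hreg₁ R hR0
    hRq 0 s' (by rw [hR0]; exact hsp) (by rw [hR0]; exact ht) (by rw [hR0]; exact hone)
  exact ⟨A, h, hle.trans hA₁A, htA, hfgA, hfrA, hregA⟩

/-- **P1ᴹ under the skeleton's dimension binder**: the same with «the local ring of `A₀` at the centre of `O` does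
not have Krull dimension `≤ 2`» (a conjunct of the skeleton's `CoreDatum`) in place of the non-zero element of
positive value (`exists_mem_centre_of_not_ringKrullDim_le_two`). [folklore] -/
theorem genExitModel_of_not_ringKrullDim_le_two :
    ∀ p : ℕ, p.Prime → ∀ (k K : Type) [Field k] [CharP k p] [Field K] [Algebra k K]
      (O : ValuationSubring K) (A₀ : Subalgebra k K) (h₀ : A₀.toSubring ≤ O.toSubring) (t : K),
      A₀.FG → t ^ p ∈ A₀ → IsFractionRing (Algebra.adjoin k (insert t (A₀ : Set K))) K →
      ¬ ringKrullDim (Localization.AtPrime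
        (Ideal.comap (Subring.inclusion h₀) (IsLocalRing.maximalIdeal O))) ≤ 2 →
      ∀ (A₁ : Subalgebra k K) (h₁ : A₁.toSubring ≤ O.toSubring), A₀ ≤ A₁ → A₁.FG →
        IsRegularLocalRing (Localization.AtPrime
          (Ideal.comap (Subring.inclusion h₁) (IsLocalRing.maximalIdeal O))) →
        ∀ s' : K, s' ^ p ∈ locAtCentre A₁.toSubring O →
          t ∈ Subring.closure (insert s' (locAtCentre A₁.toSubring O : Set K)) →
          (∃ g ∈ locAtCentre A₁.toSubring O, ∃ (_ : IsLocalRing (locAtCentre A₁.toSubring O))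
            (z : Fin 1 → locAtCentre A₁.toSubring O), IsRsopPart z ∧
            ((z 0 : locAtCentre A₁.toSubring O) : K) = s' ^ p - g ^ p) →
          ∃ (A : Subalgebra k K) (h : A.toSubring ≤ O.toSubring), A₀ ≤ A ∧ t ∈ A ∧ A.FG ∧
            IsFractionRing A K ∧ IsRegularLocalRing (Localization.AtPrime
              (Ideal.comap (Subring.inclusion h) (IsLocalRing.maximalIdeal O))) :=
  fun p hp k K _ _ _ _ O A₀ h₀ t hfg htp hfr hdim =>
    genExitModel p hp k K O A₀ h₀ t hfg htp hfr (exists_mem_centre_of_not_ringKrullDim_le_two O A₀ h₀ hdim)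

end GenExitModel

end Summit.ResolutionOfSingularities.ResolutionOfSingularities.Theorems.SwitchingDichotomy

end
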